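import Summits.KontsevichZagierPeriods.Zeta5Search.WedgeDictionaryLevelDescentVFullKModule
import HarnessLib

/-!
# Ratio lemmas R1 (in `μ`) and R2 (in `b₁`) for the combined weight (T3 descent, step L3b)

HONEST FRAMING: "systematic search; no irrationality claim unless certified".

With `Cw(b;μ)` the combined weight of `WedgeDictionaryLevelDescentVFullKModule` (`ldCw`), on every admissible row
(`0 ≤ b_j ≤ N`, `2b_j ≤ N` on `B`, `b₂ ≥ 1`, `b₇ = 0`) and for every `μ ≥ 1`:

* R1 (`ldCw_succ`): `Cw(b;μ+1)·μ(b₁+1+μ)(b₂+1+μ)(2N−ΣB+1+μ) = −Cw(b;μ)·(c₁₂+1−μ)·PB(μ)`, `PB(μ) = ∏_B(N−b_j+1+μ)`;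
* R2 (`ldCw_bump0`): `Cw(b+e₁;μ)·(d+1)(N+1−b₁)(b₁+1+μ) = Cw(b;μ)·(c₁₂+1−μ)·∏_B c₁ⱼ·(b₁+1)(N−b₁)`.

Both hold uniformly through the ghost index `μ = c₁₂+1` and above it (where both sides vanish), and off the cone (both sides
vanish).  They are the only facts about the weights used by the REL-(3) certificate (`WedgeDictionaryLevelDescentVFullRel3`).
Exact cross-checks: pub-zeta5 g9 `e7_kmodule.py` (R1 2502/2502, R2 834/834), `e7b_edge.py` (edge rows `d ∈ {1,2,3}`: R1 1971/1971, R2 657/657).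
-/

open Finset

namespace Summit.KontsevichZagierPeriods.Zeta5Search.WedgeDictionary

open Summit.KontsevichZagierPeriods.Zeta5Search.DualSeries

/-! ## R1: the ratio of the combined weight in `μ` -/

/-- `PB(μ) = ∏_{j∈B}(N − b_j + 1 + μ)` (so `PB(μ+1) = p₂(μ)` of REC-K). -/
def ldPB (a : ℕ → ℤ) (μ : ℕ) : ℚ :=
  ((a 0 : ℚ) - a 3 + 1 + μ) * ((a 0 : ℚ) - a 4 + 1 + μ) * ((a 0 : ℚ) - a 5 + 1 + μ) * ((a 0 : ℚ) - a 6 + 1 + μ)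

/-- `Pc = ∏_{j∈B} c₁ⱼ`. -/
def ldPc (a : ℕ → ℤ) : ℚ :=
  ((a 0 : ℚ) - a 1 - a 3) * ((a 0 : ℚ) - a 1 - a 4) * ((a 0 : ℚ) - a 1 - a 5) * ((a 0 : ℚ) - a 1 - a 6)

set_option maxHeartbeats 1600000 in
/-- R1 (ratio in `μ`, ghost term included, valid for every `μ ≥ 1` on admissible rows):
`Cw(b;μ+1)·μ(b₁+1+μ)(b₂+1+μ)(2N−ΣB+1+μ) = −Cw(b;μ)·(c₁₂+1−μ)·PB(μ)`. -/
theorem ldCw_succ (a : ℕ → ℤ) (hbox : ∀ j ∈ Icc 1 7, 0 ≤ a j ∧ a j ≤ a 0)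
    (hB : ∀ j ∈ Icc 3 6, 2 * a j ≤ a 0) (ha2 : 1 ≤ a 2) (ha7 : a 7 = 0) (μ : ℕ) (hμ : 1 ≤ μ) :
    ldCw a (μ + 1) * ((μ : ℚ) * ((a 1 : ℚ) + 1 + μ) * ((a 2 : ℚ) + 1 + μ) * (2 * (a 0 : ℚ) - sumB a + 1 + μ)) =
      -(ldCw a μ * (((a 0 : ℚ) - a 1 - a 2 + 1 - μ) * ldPB a μ)) := by
  by_cases hC : ∀ t ∈ ({1, 2, 7} : Finset ℕ), ∀ j ∈ Icc 3 6, 0 ≤ a 0 - a t - a j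
  swap
  · rw [ldCw_eq_zero_of_not_CC a hC, ldCw_eq_zero_of_not_CC a hC]; ring
  have hbox' := hbox; have hB' := hB
  simp only [mem_Icc] at hbox' hB'
  have hx1 := hbox' 1 (by norm_num); have hx2 := hbox' 2 (by norm_num); have hx3 := hbox' 3 (by norm_num)
  have hx4 := hbox' 4 (by norm_num); have hx5 := hbox' 5 (by norm_num); have hx6 := hbox' 6 (by norm_num)
  have hB3 := hB' 3 (by norm_num); have hB4 := hB' 4 (by norm_num); have hB5 := hB' 5 (by norm_num)
  have hB6 := hB' 6 (by norm_num)
  have hC' := hC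
  simp only [Icc_three_six, mem_insert, mem_singleton, forall_eq_or_imp, forall_eq] at hC'
  rcases (show (μ : ℤ) ≤ a 0 - a 1 - a 2 ∨ (μ : ℤ) = a 0 - a 1 - a 2 + 1 ∨ a 0 - a 1 - a 2 + 2 ≤ (μ : ℤ) by omega)
    with h | h | h
  · -- both indices carry the closed form; the ratio is the `m`-step of `Ω(b−e₂;·)`
    have c0 := ldCw_closed a hbox hB ha2 ha7 hC μ hμ (by omega)
    have c1 := ldCw_closed a hbox hB ha2 ha7 hC (μ + 1) (by omega) (by push_cast; omega)
    have w := ldStepM (lowerSlot a 2) (-(μ : ℤ)) (by omega)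
      (by simp only [lowerSlot, low2_1]; omega) (by simp only [lowerSlot, low2_2]; omega)
      (by simp only [lowerSlot, low2_7]; omega) (by simp only [lowerSlot, low2_0, low2_3]; omega)
      (by simp only [lowerSlot, low2_0, low2_4]; omega) (by simp only [lowerSlot, low2_0, low2_5]; omega)
      (by simp only [lowerSlot, low2_0, low2_6]; omega)
      (by simp only [sumB, lowerSlot, low2_0, low2_3, low2_4, low2_5, low2_6]; omega)
      (by simp only [sigmaT, lowerSlot, low2_0, low2_1, low2_2, low2_7]; omega)
    have w' : ((a 1 : ℚ) + μ + 1) * ((a 2 : ℚ) + μ) * ((μ : ℚ) + 1) * (2 * (a 0 : ℚ) - sumB a + μ + 1) *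
        ldWeightSym (lowerSlot a 2) (-((μ : ℤ) + 1)) =
          -(ldPB a μ * ((a 0 : ℚ) - a 1 - a 2 + 1 - μ) * ldWeightSym (lowerSlot a 2) (-(μ : ℤ))) := by
      rw [show (-(μ : ℤ) - 1) = -((μ : ℤ) + 1) by ring] at w
      simp only [sumB, sigmaT, lowerSlot, low2_0, low2_1, low2_2, low2_3, low2_4, low2_5, low2_6, low2_7] at w ⊢
      push_cast at w ⊢
      simp only [ha7, Int.cast_zero] at w
      simp only [ldPB]
      linear_combination w
    push_cast at c1
    have hne : ((a 2 : ℚ) + μ) * ((a 2 : ℚ) + μ + 1) ≠ 0 := by positivity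
    apply mul_right_cancel₀ hne
    linear_combination ((μ : ℚ) * ((a 1 : ℚ) + 1 + μ) * ((a 2 : ℚ) + 1 + μ) * (2 * (a 0 : ℚ) - sumB a + 1 + μ) *
        ((a 2 : ℚ) + μ)) * c1 +
      ((((a 0 : ℚ) - a 1 - a 2 + 1 - μ) * ldPB a μ) * ((a 2 : ℚ) + μ + 1)) * c0 -
      (((a 0 : ℚ) - a 1 + 1) * ldQ2 a * (μ : ℚ) * ((a 2 : ℚ) + 1 + μ)) * w'
  · -- `μ` is the ghost index: the successor weight vanishes and the factor `c₁₂+1−μ` is zero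
    have hz : ldCw a (μ + 1) = 0 := ldCw_eq_zero_of_le a (μ + 1) (by simp only [sigmaT]; push_cast; omega)
    have hq : (μ : ℚ) = (a 0 : ℚ) - a 1 - a 2 + 1 := by exact_mod_cast h
    rw [hz, zero_mul]
    linear_combination (-(ldCw a μ * ldPB a μ)) * hq
  · rw [ldCw_eq_zero_of_le a μ (by simp only [sigmaT]; omega),
      ldCw_eq_zero_of_le a (μ + 1) (by simp only [sigmaT]; push_cast; omega)]
    ring

/-! ## R2: the ratio of the combined weight in `b₁` -/

/-- `∏_B(c₂ⱼ+1)` only sees slots `0, 2` and `B`. -/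
theorem ldQ2_bump0 (a : ℕ → ℤ) : ldQ2 (bump a 0) = ldQ2 a := by
  obtain ⟨e0, _, e2, e3, e4, e5, e6, _⟩ := bump0_vals a
  simp only [ldQ2, e0, e2, e3, e4, e5, e6]

set_option maxHeartbeats 1600000 in
/-- R2 (ratio in `b₁`, valid for every `μ ≥ 1` on admissible rows):
`Cw(b+e₁;μ)·(d+1)(N+1−b₁)(b₁+1+μ) = Cw(b;μ)·(c₁₂+1−μ)·Pc·(b₁+1)(N−b₁)`. -/
theorem ldCw_bump0 (a : ℕ → ℤ) (hbox : ∀ j ∈ Icc 1 7, 0 ≤ a j ∧ a j ≤ a 0)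
    (hB : ∀ j ∈ Icc 3 6, 2 * a j ≤ a 0) (ha2 : 1 ≤ a 2) (ha7 : a 7 = 0) (μ : ℕ) (hμ : 1 ≤ μ) :
    ldCw (bump a 0) μ * ((((dOf a : ℚ) + 1) * ((a 0 : ℚ) + 1 - a 1)) * ((a 1 : ℚ) + 1 + μ)) =
      ldCw a μ * ((((a 0 : ℚ) - a 1 - a 2 + 1 - μ) * ldPc a) * (((a 1 : ℚ) + 1) * ((a 0 : ℚ) - a 1))) := by
  obtain ⟨e0, e1, e2, e3, e4, e5, e6, e7⟩ := bump0_vals a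
  have hbox' := hbox; have hB' := hB
  simp only [mem_Icc] at hbox' hB'
  have hx1 := hbox' 1 (by norm_num); have hx2 := hbox' 2 (by norm_num); have hx3 := hbox' 3 (by norm_num)
  have hx4 := hbox' 4 (by norm_num); have hx5 := hbox' 5 (by norm_num); have hx6 := hbox' 6 (by norm_num)
  have hB3 := hB' 3 (by norm_num); have hB4 := hB' 4 (by norm_num); have hB5 := hB' 5 (by norm_num)
  have hB6 := hB' 6 (by norm_num)
  by_cases hC : ∀ t ∈ ({1, 2, 7} : Finset ℕ), ∀ j ∈ Icc 3 6, 0 ≤ a 0 - a t - a j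
  swap
  · have hC1 : ¬ (∀ t ∈ ({1, 2, 7} : Finset ℕ), ∀ j ∈ Icc 3 6, 0 ≤ bump a 0 0 - bump a 0 t - bump a 0 j) := fun h' => hC (by
      simp only [Icc_three_six, mem_insert, mem_singleton, forall_eq_or_imp, forall_eq, e0, e1, e2, e3, e4,
        e5, e6, e7] at h' ⊢
      omega)
    rw [ldCw_eq_zero_of_not_CC a hC, ldCw_eq_zero_of_not_CC _ hC1]; ring
  have hC' := hC
  simp only [Icc_three_six, mem_insert, mem_singleton, forall_eq_or_imp, forall_eq] at hC'
  by_cases hP : 1 ≤ a 0 - a 1 - a 3 ∧ 1 ≤ a 0 - a 1 - a 4 ∧ 1 ≤ a 0 - a 1 - a 5 ∧ 1 ≤ a 0 - a 1 - a 6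
  swap
  · -- some `c₁ⱼ = 0`: `Pc = 0` and `b + e₁` is off the cone
    have hC1 : ¬ (∀ t ∈ ({1, 2, 7} : Finset ℕ), ∀ j ∈ Icc 3 6, 0 ≤ bump a 0 0 - bump a 0 t - bump a 0 j) := fun h' => hP (by
      simp only [Icc_three_six, mem_insert, mem_singleton, forall_eq_or_imp, forall_eq, e0, e1, e2, e3, e4,
        e5, e6, e7] at h'
      omega)
    have hz : a 0 - a 1 - a 3 = 0 ∨ a 0 - a 1 - a 4 = 0 ∨ a 0 - a 1 - a 5 = 0 ∨ a 0 - a 1 - a 6 = 0 := by omega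
    have hPz : (a 0 - a 1 - a 3) * ((a 0 - a 1 - a 4) * ((a 0 - a 1 - a 5) * (a 0 - a 1 - a 6))) = 0 := by
      rcases hz with hz | hz | hz | hz <;> simp [hz]
    have hPq : ((a 0 : ℚ) - a 1 - a 3) * (((a 0 : ℚ) - a 1 - a 4) * (((a 0 : ℚ) - a 1 - a 5) *
        ((a 0 : ℚ) - a 1 - a 6))) = 0 := by
      exact_mod_cast hPz
    rw [ldCw_eq_zero_of_not_CC _ hC1, zero_mul, ldPc]
    linear_combination (-(ldCw a μ * (((a 0 : ℚ) - a 1 - a 2 + 1 - μ)) * (((a 1 : ℚ) + 1) * ((a 0 : ℚ) - a 1)))) * hPq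
  obtain ⟨h13, h14, h15, h16⟩ := hP
  have hCp : ∀ t ∈ ({1, 2, 7} : Finset ℕ), ∀ j ∈ Icc 3 6, 0 ≤ bump a 0 0 - bump a 0 t - bump a 0 j := by
    simp only [Icc_three_six, mem_insert, mem_singleton, forall_eq_or_imp, forall_eq, e0, e1, e2, e3, e4, e5,
      e6, e7]
    omega
  have hboxp : ∀ j ∈ Icc 1 7, 0 ≤ bump a 0 j ∧ bump a 0 j ≤ bump a 0 0 := by
    intro j hj
    simp only [mem_Icc] at hj
    rw [e0, bump0_apply]
    split_ifs with hj1
    · omega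
    · exact hbox' j ⟨hj.1, hj.2⟩
  have hBp : ∀ j ∈ Icc 3 6, 2 * bump a 0 j ≤ bump a 0 0 := by
    intro j hj
    simp only [mem_Icc] at hj
    rw [e0, bump0_of_ne a (show j ≠ 1 by omega)]
    exact hB' j ⟨hj.1, hj.2⟩
  rcases (show (μ : ℤ) ≤ a 0 - a 1 - a 2 ∨ (μ : ℤ) = a 0 - a 1 - a 2 + 1 ∨ a 0 - a 1 - a 2 + 2 ≤ (μ : ℤ) by omega)
    with h | h | h
  · have hd0 := layer_le_dOf a hB ha7
    have c0 := ldCw_closed a hbox hB ha2 ha7 hC μ hμ (by omega)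
    have cp := ldCw_closed (bump a 0) hboxp hBp (by rw [e2]; exact ha2) (by rw [e7]; exact ha7) hCp μ hμ
      (by rw [e0, e1, e2]; omega)
    rw [e0, e1, e2, ldQ2_bump0, lowerSlot2_bump0_comm] at cp
    push_cast at cp
    have st := ldStep1up (lowerSlot a 2) (-(μ : ℤ)) (by rw [dOf_lowerSlot2]; omega)
      (by simp only [lowerSlot, low2_1]; omega) (by simp only [lowerSlot, low2_1]; omega)
      (by simp only [lowerSlot, low2_0, low2_1, low2_3]; omega) (by simp only [lowerSlot, low2_0, low2_1, low2_4]; omega)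
      (by simp only [lowerSlot, low2_0, low2_1, low2_5]; omega) (by simp only [lowerSlot, low2_0, low2_1, low2_6]; omega)
      (by simp only [sigmaT, lowerSlot, low2_0, low2_1, low2_2, low2_7]; omega)
    have st' : ((dOf a : ℚ) + 1) * ((a 1 : ℚ) + μ + 1) * ldWeightSym (bump (lowerSlot a 2) 0) (-(μ : ℤ)) =
        ((a 1 : ℚ) + 1) * ldPc a * ((a 0 : ℚ) - a 1 - a 2 + 1 - μ) * ldWeightSym (lowerSlot a 2) (-(μ : ℤ)) := by
      rw [dOf_lowerSlot2] at st
      have e : ∀ j, j ≠ 2 → lowerSlot a 2 j = a j := fun j hj => by simp [lowerSlot, hj]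
      simp only [sigmaT, e 0 (by decide), e 1 (by decide), e 3 (by decide), e 4 (by decide), e 5 (by decide),
        e 6 (by decide), e 7 (by decide), show lowerSlot a 2 2 = a 2 - 1 by simp [lowerSlot]] at st
      push_cast at st ⊢
      simp only [ha7, Int.cast_zero] at st
      simp only [ldPc]
      linear_combination st
    have hne : ((a 2 : ℚ) + μ) ≠ 0 := by positivity
    apply mul_right_cancel₀ hne
    linear_combination ((((dOf a : ℚ) + 1) * ((a 0 : ℚ) + 1 - a 1)) * ((a 1 : ℚ) + 1 + μ)) * cp -
      ((((a 0 : ℚ) - a 1 - a 2 + 1 - μ) * ldPc a) * (((a 1 : ℚ) + 1) * ((a 0 : ℚ) - a 1))) * c0 -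
      ((μ : ℚ) * ((a 0 : ℚ) - a 1) * ldQ2 a * ((a 0 : ℚ) + 1 - a 1)) * st'
  · have hz : ldCw (bump a 0) μ = 0 :=
      ldCw_eq_zero_of_le _ μ (by simp only [sigmaT, e0, e1, e2, e7]; omega)
    have hq : (μ : ℚ) = (a 0 : ℚ) - a 1 - a 2 + 1 := by exact_mod_cast h
    rw [hz, zero_mul]
    linear_combination (ldCw a μ * ldPc a * (((a 1 : ℚ) + 1) * ((a 0 : ℚ) - a 1))) * hq
  · rw [ldCw_eq_zero_of_le a μ (by simp only [sigmaT]; omega),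
      ldCw_eq_zero_of_le (bump a 0) μ (by simp only [sigmaT, e0, e1, e2, e7]; omega)]
    ring

/-- Documentation anchor (R1 and R2, module docstring). -/
def ldCwRatio_stmt : Prop :=
  ∀ a : ℕ → ℤ, (∀ j ∈ Icc 1 7, 0 ≤ a j ∧ a j ≤ a 0) → (∀ j ∈ Icc 3 6, 2 * a j ≤ a 0) → 1 ≤ a 2 → a 7 = 0 →
    ∀ μ : ℕ, 1 ≤ μ →
      ldCw a (μ + 1) * ((μ : ℚ) * ((a 1 : ℚ) + 1 + μ) * ((a 2 : ℚ) + 1 + μ) * (2 * (a 0 : ℚ) - sumB a + 1 + μ)) =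
          -(ldCw a μ * (((a 0 : ℚ) - a 1 - a 2 + 1 - μ) * ldPB a μ)) ∧
        ldCw (bump a 0) μ * ((((dOf a : ℚ) + 1) * ((a 0 : ℚ) + 1 - a 1)) * ((a 1 : ℚ) + 1 + μ)) =
          ldCw a μ * ((((a 0 : ℚ) - a 1 - a 2 + 1 - μ) * ldPc a) * (((a 1 : ℚ) + 1) * ((a 0 : ℚ) - a 1)))

/-- `ldCwRatio_stmt` holds. -/
theorem ldCwRatio_holds : ldCwRatio_stmt := fun a hbox hB ha2 ha7 μ hμ =>
  ⟨ldCw_succ a hbox hB ha2 ha7 μ hμ, ldCw_bump0 a hbox hB ha2 ha7 μ hμ⟩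

end Summit.KontsevichZagierPeriods.Zeta5Search.WedgeDictionary
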